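import Literature.AlgebraicGeometry.Motives.HodgeStructureCMActionReflexField
import Literature.AlgebraicGeometry.Motives.HodgeStructureOfCMTypeHomSpaces
import HarnessLib

/-!
# THE HODGE FILTRATION OF `V^n_{(F,Π)}` IS DEFINED OVER EXACTLY THE REFLEX FIELD `F′`: `(τ ⊗ 1) F^p_Π = F^p_{τΠ}`, so
# `τ ⊗ 1` preserves `F^•` (equivalently every Hodge piece `V^{p,q}`) iff `τΠ = Π` iff `τ ∈ Aut(ℂ/F′)`; the same for a strong CM-Hodge
# structure and its reflex field `E*` (GGK (V.A.3)–(V.A.4), §V.C (i); Milne 1999 §1; Kerr, *Hodge Theory* Def. 12.5.1)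

[topic AlgebraicGeometry/Motives]

Layer `Literature/AlgebraicGeometry/Motives`, lane `lit-hodgefound` (Track 2 foundations library; seat `lit-hodgefound-p02`, gen 33, row g33-#8).
THEOREMS ONLY (no definition, no named fact; D-0026 net debt `0`).  Sequel BY NAME of g33-#1 `Motives/HodgeStructureOfOrientationReflexTraceField` ((V.A.4) in
`ℂ`: `forall_deg_smul_eq_iff_forall_mem_traceField`, `traceField_le_iff_forall`), g33-#3 `Motives/HodgeStructureCMActionReflexField` (`EndAction.reflexField =
E*`, `forall_deg_orientation_smul_eq_iff_forall_mem_reflexField`), the construction `Motives/HodgeStructureOfOrientation` (`ofOrientation_F : F^p = ⊕_{p ≤ deg θ}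
ℂ_θ`, `piece_ofOrientation : V^{p,q} = ⊕_{θ ∈ Π^{p,q}} ℂ_θ`, `exists_hom_ofOrientation_bijective`), p29/pub-hodgecm's `Motives/HodgeStructureOfCMTypeHomSpaces`
(`embCoords_rTensor_aut : ((τ ⊗ 1)x)_{τσ} = τ(x_σ)`, `rTensor_aut_cmBasis : (τ ⊗ 1) e_σ = e_{τσ}`, `cmBasis_mem_coordSubspace_iff`) and
`Motives/HodgeStructureOfCMTypeBasis` (`cmBasis`).  Companion of g33-#6 `Motives/HodgeCocharacterOfOrientationFieldOfDefinition` (the same for the Hodge cocharacter `μ_Π`).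

THE PRINTS.  M. Green, P. Griffiths, M. Kerr [GreenGriffithsKerr2012] §V.A (V.A.3) p. 156 (the Galois translates `gΠ`), (V.A.4) p. 156 («`F′` … is equal to
the fixed field of `{σ ∈ Gal(F^c/ℚ) | (Π̃⁻¹)^{p,q}σ = (Π̃⁻¹)^{p,q} for all p+q=n}`»), §V.C (i) p. 161 («`V^{p,q}_ℂ := ⊕_{θ ∈ Π^{p,q}} E_θ(V_ℂ)`», «`Π^{p,q} :=
{eigenvalues of η(F) on V^{p,q}}`»).  J. S. Milne [Milne1999] §1 p. 13 (the reflex field of a CM Hodge structure as a field of definition).  M. Kerr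
[CattaniElZeinGriffithsLe2014] Ch. 12 §12.5.A Def. 12.5.1 («the fixed field of the subgroup of `Aut(ℂ)` fixing …»).  P. Deligne [Deligne1982HodgeCycles] I
Example 3.7 (b) («`H^{-1,0}` … the subspace `ℂ^Φ` of `ℂ^S`»).

THE MECHANISM.  In the eigen-coordinates `V_ℂ = ℂ ⊗ F ≅ ℂ^{Hom(F,ℂ)}`, `F^p_Π = ⊕_{deg θ ≥ p} ℂ_θ` and `τ ⊗ 1` carries the line `ℂ_θ` `τ`-semilinearly onto
`ℂ_{τθ}` (`((τ ⊗ 1)x)_{τσ} = τ(x_σ)`).  Hence `(τ ⊗ 1)(⊕_{θ ∈ S} ℂ_θ) = ⊕_{θ ∈ τS} ℂ_θ`, so `τ ⊗ 1` carries `F^p_Π` onto `F^p_{τΠ}` and `V^{p,q}_Π` onto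
`V^{p,q}_{τΠ}`; it preserves the filtration of `V_Π` iff `{deg ≥ p}` is `τ`-stable for every `p` iff `deg ∘ τ = deg` (test on `e_θ`), iff `τ` fixes `F′`
(g33-#1).  An `F`-equivariant isomorphism `V ≅ V^n_{(F,Π_φ)}` is defined over `ℚ`, so it commutes with `τ ⊗ 1` and identifies the filtrations.

WHAT IS PROVED (`F = K` a number field, `Π = Λ : Orientation K n`, `τ ⊗ 1 = τ.toRingHom.toRatAlgHom.toLinearMap.rTensor _`).
§0 `rTensor_aut_injective`, **`rTensor_aut_mem_coordSubspace_iff`** (`(τ ⊗ 1)x ∈ ⊕_{τS} ℂ_θ ⟺ x ∈ ⊕_S ℂ_θ`).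
§1 translates: `setOf_le_deg_eq_smul_of_deg_eq`, `typeSet_eq_smul_of_deg_eq` (`(τΠ)^{p,q} = τ·Π^{p,q}`), **`rTensor_aut_mem_F_ofOrientation_iff_of_deg_eq`**
(`(τ ⊗ 1)x ∈ F^p_{τΠ} ⟺ x ∈ F^p_Π`), **`rTensor_aut_mem_piece_ofOrientation_iff_of_deg_eq`** (the same for `V^{p,q}`).
§2 **`forall_rTensor_aut_mem_F_ofOrientation_iff_iff_forall_deg_smul_eq`** (`τ ⊗ 1` preserves `F^•_Π ⟺ τΠ = Π`),
**`forall_rTensor_aut_mem_F_ofOrientation_iff_iff_forall_mem_traceField`** (`⟺ τ ∈ Aut(ℂ/F′)`: `F′` is the field of definition of the Hodge filtration),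
`forall_rTensor_aut_mem_piece_ofOrientation_iff_iff_forall_deg_smul_eq` / `…_iff_forall_mem_traceField` (the same with the Hodge pieces),
`setOf_forall_rTensor_aut_mem_F_ofOrientation_iff_eq` (`{τ | τ ⊗ 1 preserves F^•} = Aut(ℂ/F′)`), **`traceField_le_iff_forall_rTensor_aut_mem_F_iff`** (`F′ ⊆ E ⟺`
the filtration is defined over `E`, `E ⊂ ℂ` countable), `…_of_finiteDimensional`.
§3 `Hom.baseChange_mem_F_iff_of_bijective` (an isomorphism of `ℚ`-Hodge structures identifies the filtrations), `forall_rTensor_aut_mem_F_iff_iff_of_hom`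
(preservation of `F^•` by `τ ⊗ 1` transports along isomorphisms), `EndAction.forall_rTensor_aut_mem_F_iff_iff_forall_deg_smul_eq`,
**`EndAction.forall_rTensor_aut_mem_F_iff_iff_forall_mem_reflexField`** (strong CM-Hodge structure
`(V, φ)`: `τ ⊗ 1` preserves `F^•V_ℂ ⟺ τ ∈ Aut(ℂ/E*)`), `EndAction.reflexField_le_iff_forall_rTensor_aut_mem_F_iff`.

HONEST SCOPE.  "`τ ⊗ 1` preserves `F^p`" is the pointwise statement `(τ ⊗ 1)x ∈ F^p ⟺ x ∈ F^p` on `V_ℂ` (`τ ⊗ 1` is only `τ`-semilinear, so no `Submodule.map`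
is formed); no descent datum / model over `F′` is constructed.  §3 needs a strong action (`[F:ℚ] = dim V`).

## References
* [GreenGriffithsKerr2012] M. Green, P. Griffiths, M. Kerr, *Mumford–Tate Groups and Domains* (2012), §V.A (V.A.3)–(V.A.4) p. 156, §V.C (i) p. 161.
* [Milne1999] J. S. Milne, *Lefschetz motives and the Tate conjecture*, Compositio Math. 117 (1999), §1 (p. 13).
* [CattaniElZeinGriffithsLe2014] M. Kerr, Ch. 12 *Shimura varieties* in *Hodge Theory* (2014), §12.5.A Def. 12.5.1.
* [Deligne1982HodgeCycles] P. Deligne, *Hodge cycles on abelian varieties*, LNM 900 (1982), I Example 3.7 (b).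

## Provenance
Lane `lit-hodgefound` (Hodge path, Track 2), prover seat `lit-hodgefound-p02` (generation 33), self-proposed row g33-#8.
-/

noncomputable section

open scoped TensorProduct Classical Pointwise
open Module NumberField Cardinal

namespace Literature.AlgebraicGeometry.Motives

namespace HodgeStructure

open RealMult (embCoords)
open Literature.NumberTheory.ComplexMultiplication

/-! ### §0 The twist `τ ⊗ 1` on the coordinate subspaces `⊕_{θ ∈ S} ℂ_θ` -/

section Twist

variable {K : Type} [Field K] [NumberField K] (τ : ℂ ≃+* ℂ)

/-- `τ ⊗ 1` is injective on `ℂ ⊗ F` (its eigen-coordinates are `τ` of those of the argument). [cite: GreenGriffithsKerr2012, §V.C (i) p. 161] -/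
theorem rTensor_aut_injective : Function.Injective (τ.toRingHom.toRatAlgHom.toLinearMap.rTensor K) := fun x y h =>
  (embCoords K).injective (funext fun σ => τ.injective (by
    rw [← embCoords_rTensor_aut τ x σ, ← embCoords_rTensor_aut τ y σ]
    exact congrArg (fun w => embCoords K w ((τ : ℂ →+* ℂ).comp σ)) (by simpa only [RingEquiv.toRingHom_eq_coe] using h)))

/-- **`(τ ⊗ 1)(⊕_{θ ∈ S} ℂ_θ) = ⊕_{θ ∈ τS} ℂ_θ`**, pointwise: `(τ ⊗ 1)x ∈ ⊕_{τS} ℂ_θ ⟺ x ∈ ⊕_S ℂ_θ` (`((τ ⊗ 1)x)_{τσ} = τ(x_σ)`).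
[cite: GreenGriffithsKerr2012, §V.A (V.A.3) p. 156, §V.C (i) p. 161] [cite: Deligne1982HodgeCycles, I Example 3.7 (b)] -/
theorem rTensor_aut_mem_coordSubspace_iff (S : Set (K →+* ℂ)) (x : ℂ ⊗[ℚ] K) :
    (τ.toRingHom.toRatAlgHom.toLinearMap.rTensor K) x ∈ coordSubspace K (τ • S) ↔ x ∈ coordSubspace K S := by
  rw [RingEquiv.toRingHom_eq_coe, mem_coordSubspace_iff, mem_coordSubspace_iff]
  constructor
  · intro h σ hσ
    have h1 := h (τ • σ) fun hmem => hσ (Set.smul_mem_smul_set_iff.mp hmem)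
    rw [show τ • σ = (τ : ℂ →+* ℂ).comp σ from rfl, embCoords_rTensor_aut] at h1
    exact (map_eq_zero_iff τ τ.injective).mp h1
  · intro h θ hθ
    have hθ' : τ⁻¹ • θ ∉ S := fun hmem => hθ (Set.mem_smul_set_iff_inv_smul_mem.mpr hmem)
    rw [show θ = (τ : ℂ →+* ℂ).comp (τ⁻¹ • θ) from (smul_inv_smul τ θ).symm, embCoords_rTensor_aut, h _ hθ', map_zero]

end Twist

/-! ### §1 `τ ⊗ 1` carries the filtration and the pieces of `V_Π` onto those of `V_{τΠ}` -/

namespace Orientation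

variable {K : Type} [Field K] [NumberField K] {n : ℤ} (Λ : Orientation K n) (τ : ℂ ≃+* ℂ)

section Translates

variable {Λ} {Λ' : Orientation K n}

omit [NumberField K] in
/-- `{θ | p ≤ deg_{τΠ} θ} = τ·{θ | p ≤ deg_Π θ}`. [cite: GreenGriffithsKerr2012, §V.A (V.A.3) p. 156] -/
theorem setOf_le_deg_eq_smul_of_deg_eq (hΛ' : ∀ θ, Λ'.deg θ = Λ.deg (τ⁻¹ • θ)) (p : ℤ) :
    {θ : K →+* ℂ | p ≤ Λ'.deg θ} = τ • {θ : K →+* ℂ | p ≤ Λ.deg θ} := by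
  ext θ
  rw [Set.mem_smul_set_iff_inv_smul_mem, Set.mem_setOf_eq, Set.mem_setOf_eq, hΛ']

omit [NumberField K] in
/-- **`(τΠ)^{p,q} = τ·Π^{p,q}`.** [cite: GreenGriffithsKerr2012, §V.A (V.A.3) p. 156] -/
theorem typeSet_eq_smul_of_deg_eq (hΛ' : ∀ θ, Λ'.deg θ = Λ.deg (τ⁻¹ • θ)) (p : ℤ) : Λ'.typeSet p = τ • Λ.typeSet p := by
  ext θ
  rw [Set.mem_smul_set_iff_inv_smul_mem, mem_typeSet_iff, mem_typeSet_iff, hΛ']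

/-- **`(τ ⊗ 1) F^p(V_Π) = F^p(V_{τΠ})`**, pointwise: `(τ ⊗ 1)x ∈ F^p_{τΠ} ⟺ x ∈ F^p_Π` (`F^p_Π = ⊕_{deg θ ≥ p} ℂ_θ`).
[cite: GreenGriffithsKerr2012, §V.A (V.A.3) p. 156, §V.C (i) p. 161] -/
theorem rTensor_aut_mem_F_ofOrientation_iff_of_deg_eq (hΛ' : ∀ θ, Λ'.deg θ = Λ.deg (τ⁻¹ • θ)) (p : ℤ) (x : ℂ ⊗[ℚ] K) :
    (τ.toRingHom.toRatAlgHom.toLinearMap.rTensor K) x ∈ (ofOrientation Λ').F p ↔ x ∈ (ofOrientation Λ).F p := by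
  rw [ofOrientation_F, ofOrientation_F, setOf_le_deg_eq_smul_of_deg_eq τ hΛ' p]
  exact rTensor_aut_mem_coordSubspace_iff τ _ x

/-- **`(τ ⊗ 1) V^{p,q}_Π = V^{p,q}_{τΠ}`**, pointwise. [cite: GreenGriffithsKerr2012, §V.A (V.A.3) p. 156, §V.C (i) p. 161] [cite: Deligne1982HodgeCycles, I Example 3.7 (b)] -/
theorem rTensor_aut_mem_piece_ofOrientation_iff_of_deg_eq (hΛ' : ∀ θ, Λ'.deg θ = Λ.deg (τ⁻¹ • θ)) (p q : ℤ) (x : ℂ ⊗[ℚ] K) :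
    (τ.toRingHom.toRatAlgHom.toLinearMap.rTensor K) x ∈ (ofOrientation Λ').piece p q ↔ x ∈ (ofOrientation Λ).piece p q := by
  by_cases hpq : p + q = n
  · rw [piece_ofOrientation Λ' hpq, piece_ofOrientation Λ hpq, typeSet_eq_smul_of_deg_eq τ hΛ' p]
    exact rTensor_aut_mem_coordSubspace_iff τ _ x
  · rw [piece_eq_bot_of_add_ne _ hpq, piece_eq_bot_of_add_ne _ hpq, Submodule.mem_bot, Submodule.mem_bot]
    exact map_eq_zero_iff _ (rTensor_aut_injective τ)

end Translates

/-! ### §2 `τ ⊗ 1` preserves the Hodge filtration of `V_Π` iff `τΠ = Π` iff `τ ∈ Aut(ℂ/F′)` -/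

/-- **`τ ⊗ 1` PRESERVES THE HODGE FILTRATION OF `V^n_{(F,Π)}` iff `τΠ = Π`** (test on the eigen-vectors `e_θ ∈ F^{deg θ}`, `(τ ⊗ 1)e_θ = e_{τθ}`;
conversely `Π` is its own `τ`-translate). [cite: GreenGriffithsKerr2012, §V.A (V.A.3)–(V.A.4) p. 156, §V.C (i) p. 161] -/
theorem forall_rTensor_aut_mem_F_ofOrientation_iff_iff_forall_deg_smul_eq :
    (∀ (p : ℤ) (x : ℂ ⊗[ℚ] K), (τ.toRingHom.toRatAlgHom.toLinearMap.rTensor K) x ∈ (ofOrientation Λ).F p ↔ x ∈ (ofOrientation Λ).F p) ↔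
      ∀ θ : K →+* ℂ, Λ.deg (τ • θ) = Λ.deg θ := by
  constructor
  · intro h θ
    have key : ∀ p : ℤ, p ≤ Λ.deg (τ • θ) ↔ p ≤ Λ.deg θ := fun p => by
      have h1 := h p (cmBasis K θ)
      rwa [RingEquiv.toRingHom_eq_coe, rTensor_aut_cmBasis, ofOrientation_F, cmBasis_mem_coordSubspace_iff,
        cmBasis_mem_coordSubspace_iff] at h1
    exact le_antisymm ((key _).mp le_rfl) ((key _).mpr le_rfl)
  · intro h p x
    exact rTensor_aut_mem_F_ofOrientation_iff_of_deg_eq τ (Λ := Λ) (Λ' := Λ) (fun θ => by rw [← h (τ⁻¹ • θ), smul_inv_smul]) p x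

/-- **THE REFLEX FIELD IS THE FIELD OF DEFINITION OF THE HODGE FILTRATION: `τ ⊗ 1` preserves `F^•(V_Π)` iff `τ ∈ Aut(ℂ/F′)`.**
[cite: GreenGriffithsKerr2012, (V.A.4) p. 156, §V.C (i) p. 161] [cite: Milne1999, §1 (p. 13)] [cite: CattaniElZeinGriffithsLe2014, Ch. 12 (M. Kerr) §12.5.A Definition 12.5.1] -/
theorem forall_rTensor_aut_mem_F_ofOrientation_iff_iff_forall_mem_traceField :
    (∀ (p : ℤ) (x : ℂ ⊗[ℚ] K), (τ.toRingHom.toRatAlgHom.toLinearMap.rTensor K) x ∈ (ofOrientation Λ).F p ↔ x ∈ (ofOrientation Λ).F p) ↔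
      ∀ z : ℂ, z ∈ Λ.traceField → τ z = z :=
  (Λ.forall_rTensor_aut_mem_F_ofOrientation_iff_iff_forall_deg_smul_eq τ).trans (Λ.forall_deg_smul_eq_iff_forall_mem_traceField τ)

/-- **`τ ⊗ 1` preserves every Hodge piece `V^{p,q}_Π` iff `τΠ = Π`** (`e_θ ∈ V^{deg θ, n − deg θ}` and `(τ ⊗ 1)e_θ = e_{τθ}`).
[cite: GreenGriffithsKerr2012, §V.C (i) p. 161 («Π^{p,q} := {eigenvalues of η(F) on V^{p,q}}»), (V.A.4) p. 156] -/
theorem forall_rTensor_aut_mem_piece_ofOrientation_iff_iff_forall_deg_smul_eq :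
    (∀ (p q : ℤ) (x : ℂ ⊗[ℚ] K),
        (τ.toRingHom.toRatAlgHom.toLinearMap.rTensor K) x ∈ (ofOrientation Λ).piece p q ↔ x ∈ (ofOrientation Λ).piece p q) ↔
      ∀ θ : K →+* ℂ, Λ.deg (τ • θ) = Λ.deg θ := by
  constructor
  · intro h θ
    have h1 := h (Λ.deg θ) (n - Λ.deg θ) (cmBasis K θ)
    rw [RingEquiv.toRingHom_eq_coe, rTensor_aut_cmBasis, piece_ofOrientation Λ (by ring), cmBasis_mem_coordSubspace_iff,
      cmBasis_mem_coordSubspace_iff, mem_typeSet_iff, mem_typeSet_iff] at h1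
    exact h1.mpr rfl
  · intro h p q x
    exact rTensor_aut_mem_piece_ofOrientation_iff_of_deg_eq τ (Λ := Λ) (Λ' := Λ) (fun θ => by rw [← h (τ⁻¹ • θ), smul_inv_smul]) p q x

/-- `τ ⊗ 1` preserves every `V^{p,q}_Π` iff `τ ∈ Aut(ℂ/F′)`. [cite: GreenGriffithsKerr2012, (V.A.4) p. 156, §V.C (i) p. 161] [cite: Milne1999, §1 (p. 13)] -/
theorem forall_rTensor_aut_mem_piece_ofOrientation_iff_iff_forall_mem_traceField :
    (∀ (p q : ℤ) (x : ℂ ⊗[ℚ] K),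
        (τ.toRingHom.toRatAlgHom.toLinearMap.rTensor K) x ∈ (ofOrientation Λ).piece p q ↔ x ∈ (ofOrientation Λ).piece p q) ↔
      ∀ z : ℂ, z ∈ Λ.traceField → τ z = z :=
  (Λ.forall_rTensor_aut_mem_piece_ofOrientation_iff_iff_forall_deg_smul_eq τ).trans (Λ.forall_deg_smul_eq_iff_forall_mem_traceField τ)

/-- As subsets of `Aut(ℂ)`: **`{τ | τ ⊗ 1 preserves F^•(V_Π)} = Aut(ℂ/F′)`** (Kerr's shape of Def. 12.5.1).
[cite: CattaniElZeinGriffithsLe2014, Ch. 12 (M. Kerr) §12.5.A Definition 12.5.1] [cite: GreenGriffithsKerr2012, (V.A.4) p. 156] -/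
theorem setOf_forall_rTensor_aut_mem_F_ofOrientation_iff_eq :
    {τ : ℂ ≃+* ℂ | ∀ (p : ℤ) (x : ℂ ⊗[ℚ] K),
        (τ.toRingHom.toRatAlgHom.toLinearMap.rTensor K) x ∈ (ofOrientation Λ).F p ↔ x ∈ (ofOrientation Λ).F p} =
      {τ : ℂ ≃+* ℂ | ∀ z : ℂ, z ∈ Λ.traceField → τ z = z} :=
  Set.ext fun τ => Λ.forall_rTensor_aut_mem_F_ofOrientation_iff_iff_forall_mem_traceField τ

/-- **`F′ ⊆ E` iff the Hodge filtration of `V_Π` is defined over `E`** (preserved by `Aut(ℂ/E)`), for a countable subfield `E ⊂ ℂ`.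
[cite: GreenGriffithsKerr2012, (V.A.4) p. 156] [cite: Milne1999, §1 (p. 13)] -/
theorem traceField_le_iff_forall_rTensor_aut_mem_F_iff (E : IntermediateField ℚ ℂ) (hE : #E.toSubfield ≤ ℵ₀) :
    Λ.traceField ≤ E ↔ ∀ τ : ℂ ≃+* ℂ, (∀ z : ℂ, z ∈ E → τ z = z) → ∀ (p : ℤ) (x : ℂ ⊗[ℚ] K),
      (τ.toRingHom.toRatAlgHom.toLinearMap.rTensor K) x ∈ (ofOrientation Λ).F p ↔ x ∈ (ofOrientation Λ).F p := by
  rw [Λ.traceField_le_iff_forall E hE]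
  exact forall_congr' fun τ => forall_congr' fun _ => (Λ.forall_rTensor_aut_mem_F_ofOrientation_iff_iff_forall_deg_smul_eq τ).symm

/-- The same for a number field `E ⊂ ℂ`. [cite: GreenGriffithsKerr2012, (V.A.4) p. 156] [cite: Milne1999, §1 (p. 13)] -/
theorem traceField_le_iff_forall_rTensor_aut_mem_F_iff_of_finiteDimensional (E : IntermediateField ℚ ℂ) [FiniteDimensional ℚ E] :
    Λ.traceField ≤ E ↔ ∀ τ : ℂ ≃+* ℂ, (∀ z : ℂ, z ∈ E → τ z = z) → ∀ (p : ℤ) (x : ℂ ⊗[ℚ] K),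
      (τ.toRingHom.toRatAlgHom.toLinearMap.rTensor K) x ∈ (ofOrientation Λ).F p ↔ x ∈ (ofOrientation Λ).F p := by
  rw [Λ.traceField_le_iff_forall_of_finiteDimensional E]
  exact forall_congr' fun τ => forall_congr' fun _ => (Λ.forall_rTensor_aut_mem_F_ofOrientation_iff_iff_forall_deg_smul_eq τ).symm

end Orientation

/-! ### §3 Strong CM-Hodge structures: `E*` is the field of definition of the Hodge filtration -/

section Transport

variable {n : ℤ} (τ : ℂ ≃+* ℂ)
variable {V₁ : Type} [AddCommGroup V₁] [Module ℚ V₁] {V₂ : Type} [AddCommGroup V₂] [Module ℚ V₂]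
variable {H₁ : HodgeStructure V₁ n} {H₂ : HodgeStructure V₂ n}

/-- A `ℚ`-linear map commutes with the twists: `g_ℂ ∘ (τ ⊗ 1) = (τ ⊗ 1) ∘ g_ℂ` (g32-#2 `baseChange_rTensor_aut`, local copy). [folklore] -/
private theorem baseChange_rTensor_aut' (g : V₁ →ₗ[ℚ] V₂) (x : ℂ ⊗[ℚ] V₁) :
    g.baseChange ℂ ((τ.toRingHom.toRatAlgHom.toLinearMap.rTensor V₁) x) = (τ.toRingHom.toRatAlgHom.toLinearMap.rTensor V₂) (g.baseChange ℂ x) := by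
  induction x using TensorProduct.induction_on with
  | zero => simp only [map_zero]
  | tmul c v => simp only [LinearMap.rTensor_tmul, LinearMap.baseChange_tmul]
  | add x y hx hy => simp only [map_add, hx, hy]

omit τ in
/-- `e_ℂ (e⁻¹_ℂ y) = y` for an isomorphism of Hodge structures. Private plumbing. [folklore] -/
private theorem baseChange_inverse_apply (e : Hom H₁ H₂) (he : Function.Bijective e.toLinearMap) (y : ℂ ⊗[ℚ] V₂) :
    e.toLinearMap.baseChange ℂ ((e.inverse he).toLinearMap.baseChange ℂ y) = y := by
  induction y using TensorProduct.induction_on with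
  | zero => simp only [map_zero]
  | tmul c w => rw [LinearMap.baseChange_tmul, LinearMap.baseChange_tmul, Hom.apply_inverse_apply]
  | add x y hx hy => simp only [map_add, hx, hy]

omit τ in
/-- `e⁻¹_ℂ (e_ℂ x) = x`. Private plumbing. [folklore] -/
private theorem inverse_baseChange_apply (e : Hom H₁ H₂) (he : Function.Bijective e.toLinearMap) (x : ℂ ⊗[ℚ] V₁) :
    (e.inverse he).toLinearMap.baseChange ℂ (e.toLinearMap.baseChange ℂ x) = x := by
  induction x using TensorProduct.induction_on with
  | zero => simp only [map_zero]
  | tmul c v => rw [LinearMap.baseChange_tmul, LinearMap.baseChange_tmul, Hom.inverse_apply_apply]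
  | add x y hx hy => simp only [map_add, hx, hy]

omit τ in
/-- **An isomorphism of `ℚ`-Hodge structures identifies the Hodge filtrations**: `e_ℂ x ∈ F^p(H₂) ⟺ x ∈ F^p(H₁)` (both `e` and `e⁻¹` are morphisms).
[cite: Deligne1982HodgeCycles, I §3 proof of Prop. 3.4] -/
theorem Hom.baseChange_mem_F_iff_of_bijective (e : Hom H₁ H₂) (he : Function.Bijective e.toLinearMap) (p : ℤ) (x : ℂ ⊗[ℚ] V₁) :
    e.toLinearMap.baseChange ℂ x ∈ H₂.F p ↔ x ∈ H₁.F p :=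
  ⟨fun h => by
    have h' := (e.inverse he).map_F_le p ⟨_, h, rfl⟩
    rwa [inverse_baseChange_apply] at h',
    fun h => e.map_F_le p ⟨x, h, rfl⟩⟩

/-- **Preservation of `F^•` by `τ ⊗ 1` transports along isomorphisms of `ℚ`-Hodge structures** (`e_ℂ` is defined over `ℚ`, so it commutes with `τ ⊗ 1`,
as in g32-#2 `baseChange_rTensor_aut`). [cite: Deligne1982HodgeCycles, I §3 proof of Prop. 3.4] -/
theorem forall_rTensor_aut_mem_F_iff_iff_of_hom (e : Hom H₁ H₂) (he : Function.Bijective e.toLinearMap) :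
    (∀ (p : ℤ) (x : ℂ ⊗[ℚ] V₁), (τ.toRingHom.toRatAlgHom.toLinearMap.rTensor V₁) x ∈ H₁.F p ↔ x ∈ H₁.F p) ↔
      ∀ (p : ℤ) (y : ℂ ⊗[ℚ] V₂), (τ.toRingHom.toRatAlgHom.toLinearMap.rTensor V₂) y ∈ H₂.F p ↔ y ∈ H₂.F p := by
  constructor
  · intro h p y
    rw [← baseChange_inverse_apply e he y, ← baseChange_rTensor_aut', e.baseChange_mem_F_iff_of_bijective he,
      e.baseChange_mem_F_iff_of_bijective he, h]
  · intro h p x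
    rw [← e.baseChange_mem_F_iff_of_bijective he p, baseChange_rTensor_aut', h, e.baseChange_mem_F_iff_of_bijective he]

end Transport

namespace EndAction

variable {K : Type} [Field K] [NumberField K] {n : ℤ}
variable {V : Type} [AddCommGroup V] [Module ℚ V] [Module.Finite ℚ V] {H : HodgeStructure V n}
variable (A : EndAction H K) (τ : ℂ ≃+* ℂ)

/-- **`τ ⊗ 1` preserves the Hodge filtration of a strong CM-Hodge structure `(V, φ)` iff `τ` stabilises `Π_φ`** (transport along `V ≅ V^n_{(F,Π_φ)}`).
[cite: GreenGriffithsKerr2012, §V.C (i) p. 161, (V.A.4) p. 156] -/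
theorem forall_rTensor_aut_mem_F_iff_iff_forall_deg_smul_eq (hS : Module.finrank ℚ K = Module.finrank ℚ V) :
    (∀ (p : ℤ) (x : ℂ ⊗[ℚ] V), (τ.toRingHom.toRatAlgHom.toLinearMap.rTensor V) x ∈ H.F p ↔ x ∈ H.F p) ↔
      ∀ θ : K →+* ℂ, (A.orientation hS).deg (τ • θ) = (A.orientation hS).deg θ := by
  obtain ⟨f, hf, -⟩ := A.exists_hom_ofOrientation_bijective hS
  rw [← forall_rTensor_aut_mem_F_iff_iff_of_hom τ f hf]
  exact (A.orientation hS).forall_rTensor_aut_mem_F_ofOrientation_iff_iff_forall_deg_smul_eq τ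

/-- **THE REFLEX FIELD `E*` OF A STRONG CM-HODGE STRUCTURE IS THE FIELD OF DEFINITION OF ITS HODGE FILTRATION: `τ ⊗ 1` preserves `F^•V_ℂ` iff
`τ ∈ Aut(ℂ/E*)`**, `E* = ℚ(tr(φ(f)|V^{p,q}))` (g33-#3). [cite: Milne1999, §1 (p. 13)] [cite: GreenGriffithsKerr2012, (V.A.4) p. 156, §V.C (i) p. 161]
[cite: CattaniElZeinGriffithsLe2014, Ch. 12 (M. Kerr) §12.5.A Definition 12.5.1] -/
theorem forall_rTensor_aut_mem_F_iff_iff_forall_mem_reflexField (hS : Module.finrank ℚ K = Module.finrank ℚ V) :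
    (∀ (p : ℤ) (x : ℂ ⊗[ℚ] V), (τ.toRingHom.toRatAlgHom.toLinearMap.rTensor V) x ∈ H.F p ↔ x ∈ H.F p) ↔
      ∀ z : ℂ, z ∈ A.reflexField → τ z = z :=
  (A.forall_rTensor_aut_mem_F_iff_iff_forall_deg_smul_eq τ hS).trans (A.forall_deg_orientation_smul_eq_iff_forall_mem_reflexField hS τ)

/-- **`E* ⊆ E` iff the Hodge filtration of `V` is defined over the number field `E ⊂ ℂ`.** [cite: Milne1999, §1 (p. 13)] [cite: GreenGriffithsKerr2012, (V.A.4) p. 156] -/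
theorem reflexField_le_iff_forall_rTensor_aut_mem_F_iff (hS : Module.finrank ℚ K = Module.finrank ℚ V) (E : IntermediateField ℚ ℂ) [FiniteDimensional ℚ E] :
    A.reflexField ≤ E ↔ ∀ τ : ℂ ≃+* ℂ, (∀ z : ℂ, z ∈ E → τ z = z) → ∀ (p : ℤ) (x : ℂ ⊗[ℚ] V),
      (τ.toRingHom.toRatAlgHom.toLinearMap.rTensor V) x ∈ H.F p ↔ x ∈ H.F p := by
  rw [A.reflexField_eq_traceField hS, (A.orientation hS).traceField_le_iff_forall_of_finiteDimensional E]
  exact forall_congr' fun τ => forall_congr' fun _ => (A.forall_rTensor_aut_mem_F_iff_iff_forall_deg_smul_eq τ hS).symm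

end EndAction

end HodgeStructure

end Literature.AlgebraicGeometry.Motives
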